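import Mathlib
import Summits.Ventures.PercRepro2.Defs
import Summits.Ventures.PercRepro2.Graph
import Summits.Ventures.PercRepro2.OneColourSwitch
import Summits.Ventures.PercRepro2.RegionHubSign
import Summits.Ventures.PercRepro2.SideSwitch
import Summits.Ventures.PercRepro2.SideSwitchM9
import Summits.Ventures.PercRepro2.SideSwitchComps
import Summits.Ventures.PercRepro2.M9CornerHarris
import Summits.Ventures.PercRepro2.M9NoPocketDefs

/-!
# The legal side vectors of a typed representative are a corner pair (blind cell PercRepro2,
p3 g32, 2026-08-28; `proofs/P3-BULK.md` §1)

For a typed representative `ρ` of the single-`d` fibration (`M9NoPocketDefs`) without `T`-edges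
(`d` adjacent to neither `r` nor `s`, `Tset = ∅`), write `deadBlocks` for the blocks of `G − d`
carrying a dead (`W`) edge from `d`, `sameBlocks` for those carrying a same (`Y`) edge and
`joinedBlocks` for their union.  The legal coordinate vectors `L4` are then EXACTLY: every side
vector when there is no dead edge or no same edge (the two «types constant» cubes), and otherwise
the CORNER PAIR of the joined blocks — the side vectors in which the joined blocks are all on the
`A`-side or all on the `B`-side (`mem_L4_iff_of_Tset_empty`, `L4_eq_corners_of_Tset_empty`,
`L4_eq_powerset_of_Tset_empty`): the «sides constant» cubes.  This is the four-cube shape of the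
type-free fibre (the union over the types of `ρ` of these legal sets), in the vocabulary of
`M9CornerHarris.corners`.  Own work; std axioms.
-/

namespace Summit.Ventures.PercRepro2

namespace NoPocket

open Finset Classical SideSwitch

variable {V : Type*} {E : Type*} [Fintype V] [DecidableEq V] [Fintype E] [DecidableEq E]

variable (ends : E → Sym2 V)

/-- The blocks of `G − d` carrying a dead edge from `d` (a `W` edge in the representative). -/
noncomputable def deadBlocks (d r s : V) (ρ : Config E) : Finset (Finset V) :=
  (blocks ends d r s ρ).filter (fun C => hasW ends d ρ C)

/-- The blocks of `G − d` carrying a same edge from `d` (a `Y` edge in the representative). -/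
noncomputable def sameBlocks (d r s : V) (ρ : Config E) : Finset (Finset V) :=
  (blocks ends d r s ρ).filter (fun C => hasY ends d ρ C)

/-- The blocks joined to `d`: a same edge or a dead edge. -/
noncomputable def joinedBlocks (d r s : V) (ρ : Config E) : Finset (Finset V) :=
  sameBlocks ends d r s ρ ∪ deadBlocks ends d r s ρ

variable {ends}

omit [Fintype E] [DecidableEq E] in
/-- Membership in `deadBlocks`. -/
lemma mem_deadBlocks {d r s : V} {ρ : Config E} {C : Finset V} :
    C ∈ deadBlocks ends d r s ρ ↔ C ∈ blocks ends d r s ρ ∧ hasW ends d ρ C := by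
  simp [deadBlocks]

omit [Fintype E] [DecidableEq E] in
/-- Membership in `sameBlocks`. -/
lemma mem_sameBlocks {d r s : V} {ρ : Config E} {C : Finset V} :
    C ∈ sameBlocks ends d r s ρ ↔ C ∈ blocks ends d r s ρ ∧ hasY ends d ρ C := by
  simp [sameBlocks]

omit [Fintype E] [DecidableEq E] in
/-- Membership in `joinedBlocks`. -/
lemma mem_joinedBlocks {d r s : V} {ρ : Config E} {C : Finset V} :
    C ∈ joinedBlocks ends d r s ρ ↔
      C ∈ blocks ends d r s ρ ∧ (hasY ends d ρ C ∨ hasW ends d ρ C) := by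
  simp only [joinedBlocks, Finset.mem_union, mem_sameBlocks, mem_deadBlocks]
  tauto

omit [DecidableEq E] in
/-- Without `T`-edges, `d` has a `Y`-source in `x` exactly when some same-block is on the
`A`-side. -/
lemma srcY_iff_of_Tset_empty {d r s : V} (hT : Tset ends d r s = ∅) {ρ : Config E}
    {x : Finset (Finset V) × Finset E} :
    srcY ends d r s ρ x ↔ ¬ sameBlocks ends d r s ρ ⊆ x.1 := by
  unfold srcY
  rw [hT]
  simp only [Finset.notMem_empty, false_and, exists_false, false_or, Finset.subset_iff,
    mem_sameBlocks, not_forall]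
  constructor
  · rintro ⟨C, hC, hCx, hY⟩
    exact ⟨C, ⟨hC, hY⟩, hCx⟩
  · rintro ⟨C, ⟨hC, hY⟩, hCx⟩
    exact ⟨C, hC, hCx, hY⟩

omit [DecidableEq E] in
/-- Without `T`-edges, `d` has a `W`-source in `x` exactly when some same-block is on the
`B`-side. -/
lemma srcW_iff_of_Tset_empty {d r s : V} (hT : Tset ends d r s = ∅) {ρ : Config E}
    {x : Finset (Finset V) × Finset E} (hx : x.1 ⊆ blocks ends d r s ρ) :
    srcW ends d r s ρ x ↔ ∃ C ∈ sameBlocks ends d r s ρ, C ∈ x.1 := by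
  unfold srcW
  rw [hT]
  simp only [Finset.notMem_empty, and_false, exists_false, false_or, mem_sameBlocks]
  constructor
  · rintro ⟨C, hCx, hY⟩
    exact ⟨C, ⟨hx hCx, hY⟩, hCx⟩
  · rintro ⟨C, ⟨_, hY⟩, hCx⟩
    exact ⟨C, hCx, hY⟩

omit [DecidableEq E] in
/-- **The legal vectors without `T`-edges**: `x` is legal iff its `T`-part is empty, its blocks are
blocks, and either there is no dead edge, or no same edge, or the joined blocks are all on the
`A`-side, or all on the `B`-side. -/
theorem mem_L4_iff_of_Tset_empty {d r s : V} (hT : Tset ends d r s = ∅) {ρ : Config E}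
    {x : Finset (Finset V) × Finset E} :
    x ∈ L4 ends d r s ρ ↔ x.1 ⊆ blocks ends d r s ρ ∧ x.2 = ∅ ∧
      (deadBlocks ends d r s ρ = ∅ ∨ sameBlocks ends d r s ρ = ∅ ∨
        joinedBlocks ends d r s ρ ∩ x.1 = ∅ ∨ joinedBlocks ends d r s ρ ⊆ x.1) := by
  rw [mem_L4, hT, Finset.subset_empty]
  constructor
  · rintro ⟨⟨hx1, hx2⟩, hA, hB⟩
    refine ⟨hx1, hx2, ?_⟩
    by_cases hD : deadBlocks ends d r s ρ = ∅
    · exact Or.inl hD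
    by_cases hS : sameBlocks ends d r s ρ = ∅
    · exact Or.inr (Or.inl hS)
    right; right
    -- the two legality conditions in block language
    have hA' : (∃ C ∈ sameBlocks ends d r s ρ, C ∈ x.1) → deadBlocks ends d r s ρ ⊆ x.1 := by
      intro h C hC
      rw [mem_deadBlocks] at hC
      by_contra hCx
      exact hA ((srcW_iff_of_Tset_empty hT hx1).2 h) C hC.1 hCx hC.2
    have hB' : ¬ sameBlocks ends d r s ρ ⊆ x.1 → deadBlocks ends d r s ρ ∩ x.1 = ∅ := by
      intro h
      rw [Finset.eq_empty_iff_forall_notMem]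
      intro C hC
      rw [Finset.mem_inter, mem_deadBlocks] at hC
      exact hB ((srcY_iff_of_Tset_empty hT).2 h) C hC.2 hC.1.2
    by_cases hmeet : ∃ C ∈ sameBlocks ends d r s ρ, C ∈ x.1
    · have hDx := hA' hmeet
      by_cases hSx : sameBlocks ends d r s ρ ⊆ x.1
      · exact Or.inr (Finset.union_subset hSx hDx)
      · exfalso
        have hDd := hB' hSx
        obtain ⟨C, hC⟩ := Finset.nonempty_iff_ne_empty.2 hD
        have : C ∈ deadBlocks ends d r s ρ ∩ x.1 := Finset.mem_inter.2 ⟨hC, hDx hC⟩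
        rw [hDd] at this
        exact Finset.notMem_empty C this
    · left
      have hSx : ¬ sameBlocks ends d r s ρ ⊆ x.1 := by
        intro hsub
        obtain ⟨C, hC⟩ := Finset.nonempty_iff_ne_empty.2 hS
        exact hmeet ⟨C, hC, hsub hC⟩
      have hDd := hB' hSx
      rw [Finset.eq_empty_iff_forall_notMem]
      intro C hC
      rw [Finset.mem_inter, mem_joinedBlocks] at hC
      rcases hC.1.2 with hY | hW
      · exact hmeet ⟨C, mem_sameBlocks.2 ⟨hC.1.1, hY⟩, hC.2⟩
      · have : C ∈ deadBlocks ends d r s ρ ∩ x.1 :=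
          Finset.mem_inter.2 ⟨mem_deadBlocks.2 ⟨hC.1.1, hW⟩, hC.2⟩
        rw [hDd] at this
        exact Finset.notMem_empty C this
  · rintro ⟨hx1, hx2, hcase⟩
    refine ⟨⟨hx1, hx2⟩, ?_, ?_⟩
    · -- a `W`-source forces every dead block to the `B`-side
      intro hW C hC hCx hCW
      have hCd : C ∈ deadBlocks ends d r s ρ := mem_deadBlocks.2 ⟨hC, hCW⟩
      obtain ⟨C', hC'S, hC'x⟩ := (srcW_iff_of_Tset_empty hT hx1).1 hW
      rcases hcase with hD | hS | hJ | hJ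
      · rw [hD] at hCd; exact Finset.notMem_empty C hCd
      · rw [hS] at hC'S; exact Finset.notMem_empty C' hC'S
      · have : C' ∈ joinedBlocks ends d r s ρ ∩ x.1 :=
          Finset.mem_inter.2 ⟨Finset.mem_union_left _ hC'S, hC'x⟩
        rw [hJ] at this; exact Finset.notMem_empty C' this
      · exact hCx (hJ (Finset.mem_union_right _ hCd))
    · -- a `Y`-source forces every dead block to the `A`-side
      intro hY C hCx hCW
      have hCd : C ∈ deadBlocks ends d r s ρ := mem_deadBlocks.2 ⟨hx1 hCx, hCW⟩
      have hnot := (srcY_iff_of_Tset_empty hT).1 hY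
      rcases hcase with hD | hS | hJ | hJ
      · rw [hD] at hCd; exact Finset.notMem_empty C hCd
      · exact hnot (by rw [hS]; exact Finset.empty_subset _)
      · have : C ∈ joinedBlocks ends d r s ρ ∩ x.1 :=
          Finset.mem_inter.2 ⟨Finset.mem_union_right _ hCd, hCx⟩
        rw [hJ] at this; exact Finset.notMem_empty C this
      · exact hnot (fun C' hC' => hJ (Finset.mem_union_left _ hC'))

omit [DecidableEq E] in
/-- **Types constant**: with no dead edge or no same edge, every side vector is legal. -/
theorem L4_eq_powerset_of_Tset_empty {d r s : V} (hT : Tset ends d r s = ∅) {ρ : Config E}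
    (h : deadBlocks ends d r s ρ = ∅ ∨ sameBlocks ends d r s ρ = ∅) :
    L4 ends d r s ρ = (blocks ends d r s ρ).powerset ×ˢ ({∅} : Finset (Finset E)) := by
  ext x
  rw [mem_L4_iff_of_Tset_empty hT, Finset.mem_product, Finset.mem_powerset,
    Finset.mem_singleton]
  constructor
  · rintro ⟨h1, h2, _⟩; exact ⟨h1, h2⟩
  · rintro ⟨h1, h2⟩
    refine ⟨h1, h2, ?_⟩
    rcases h with h | h
    · exact Or.inl h
    · exact Or.inr (Or.inl h)

omit [DecidableEq E] in
/-- **Sides constant**: with a dead edge and a same edge, the legal vectors are exactly the corner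
pair of the joined blocks (`M9CornerHarris.corners`) with an empty `T`-part. -/
theorem L4_eq_corners_of_Tset_empty {d r s : V} (hT : Tset ends d r s = ∅) {ρ : Config E}
    (hD : deadBlocks ends d r s ρ ≠ ∅) (hS : sameBlocks ends d r s ρ ≠ ∅) :
    L4 ends d r s ρ =
      corners (blocks ends d r s ρ) (joinedBlocks ends d r s ρ) ×ˢ ({∅} : Finset (Finset E)) := by
  ext x
  rw [mem_L4_iff_of_Tset_empty hT, Finset.mem_product, Finset.mem_singleton, corners,
    Finset.mem_filter, Finset.mem_powerset]
  constructor
  · rintro ⟨h1, h2, hcase⟩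
    refine ⟨⟨h1, ?_⟩, h2⟩
    rcases hcase with h | h | h | h
    · exact absurd h hD
    · exact absurd h hS
    · exact Or.inl h
    · exact Or.inr h
  · rintro ⟨⟨h1, hc⟩, h2⟩
    refine ⟨h1, h2, ?_⟩
    rcases hc with h | h
    · exact Or.inr (Or.inr (Or.inl h))
    · exact Or.inr (Or.inr (Or.inr h))

omit [Fintype E] [DecidableEq E] in
/-- The joined blocks are blocks. -/
lemma joinedBlocks_subset {d r s : V} {ρ : Config E} :
    joinedBlocks ends d r s ρ ⊆ blocks ends d r s ρ := by
  intro C hC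
  exact (mem_joinedBlocks.1 hC).1

omit [Fintype E] [DecidableEq E] in
/-- With a dead edge and a same edge the joined blocks are nonempty, so the corner pair is a
genuine pair (`sum_corners_eq` applies). -/
lemma joinedBlocks_nonempty_of_dead {d r s : V} {ρ : Config E}
    (hD : deadBlocks ends d r s ρ ≠ ∅) : (joinedBlocks ends d r s ρ).Nonempty := by
  obtain ⟨C, hC⟩ := Finset.nonempty_iff_ne_empty.2 hD
  exact ⟨C, Finset.mem_union_right _ hC⟩

end NoPocket

end Summit.Ventures.PercRepro2
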